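import Summits.Ventures.PercRepro.Night2ThreeTwoBasisAssembly

/-!
# PercRepro — the cell `(3, 2)` for `|V| ≥ 11`: the basis pairs' inequality from the quadratic count sum, the assembly
(night-2, gen 25)

`Night2ThreeTwoBasisAssembly` has the pieces: the income from a subfamily of targets with bounds, the good targets of a
profile `(i, j)` counted by the binomial product, the floors `cFloor` and the sum `qSum`.  Here they are assembled:

* **`basis_pair_fair_of_qSum`**: for a lossy basis pair `(B, z)` of a flat with `|V| ≥ 11` and the common line `ℓ`, if the
  face losses of every covering basis sum to at most `E > 0` and `E ≤ qSum |ℓ| |V ∖ ℓ| i₀ j₀ |V|` for the profile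
  `(i₀, j₀)` of `B ∪ {z}`, then `loss B z ≤ rhoL B z · lossIncomeH B z` — the income through the good targets is at least
  `(2^{n−4} − 1)/E · qSum ≥ 2^{n−4} − 1 = #targets`.
-/

namespace PercRepro.Shadow

open Finset PerFlat ThmH

variable {α : Type*} [DecidableEq α] {M : Matroid α} [M.Finite]

section Main

variable {G : Finset α}

omit [DecidableEq α] [M.Finite] in
/-- The summand of `qSum` is nonnegative. -/
theorem qSum_term_nonneg (L y i₀ j₀ n i j : ℕ) :
    0 ≤ ((L - i₀).choose (i - i₀) * (y - j₀).choose (j - j₀) : ℚ) * cFloor n (i + j) / (lineCount i j : ℚ) :=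
  div_nonneg (mul_nonneg (by positivity) (cFloor_nonneg n (i + j))) (by positivity)

open scoped Classical in
/-- **THE BASIS PAIRS' INEQUALITY FROM THE QUADRATIC COUNT SUM** (cell `(3, 2)`, `|V| ≥ 11`, `P` = the big members,
`ℓ` the common line): for a lossy basis pair `(B, z)`, if the face losses of every covering basis sum to at most `E > 0`
and `E ≤ qSum |ℓ| |V ∖ ℓ| i₀ j₀ |V|` for the profile `(i₀, j₀)` of `B ∪ {z}`, then
`loss B z ≤ rhoL B z · lossIncomeH B z`. -/
theorem basis_pair_fair_of_qSum (hG : G ∈ flatsQ M (5 + 1)) (hd : (gr M \ G).card = 3) (hk : kColoops M G = 2)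
    (hs : ∀ e ∈ gr M, ∀ f ∈ gr M, e ≠ f → rkN M {e, f} = 2) (hl : ∀ e ∈ gr M, M.Indep {e})
    (h11 : 11 ≤ (G \ coloops M G).card) {P : Finset α → Prop} [DecidablePred P]
    (hP : ∀ B, P B ↔ 4 ≤ (B \ coloops M G).card)
    {ℓ : Finset α} (hℓr : rkN M ℓ ≤ 2) (hℓ2 : 2 ≤ ℓ.card) (hℓV : ℓ ⊆ G \ coloops M G)
    (hℓcl : ∀ x ∈ G \ coloops M G, x ∈ clF M ℓ → x ∈ ℓ)
    (hℓ : ∀ B ∈ thinMembers M 5 G, (G \ clF M B).card ≤ 3 → ℓ ⊆ clF M B)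
    {B : Finset α} (hB : B ∈ thinMembers M 5 G) (hnP : ¬ P B) {z : α} (hz : z ∈ G \ clF M B)
    (hl0 : loss M 5 G B z ≠ 0) {E : ℚ} (hE : 0 < E)
    (hTE : ∀ S ⊆ G, ∀ T ∈ coverBases M G S 4, ∑ w ∈ T, faceLoss M 5 G (coloops M G ∪ T) w ≤ E)
    (hsum : E ≤ qSum ℓ.card ((G \ coloops M G) \ ℓ).card (profileAt (coloops M G) ℓ (insert z B)).1
      (profileAt (coloops M G) ℓ (insert z B)).2 (G \ coloops M G).card) :
    loss M 5 G B z ≤ rhoL M 5 G B z * lossIncomeH M 5 G P (dshMissed M 5 G) B z := by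
  have hd' : (gr M \ G).card ≤ 5 := by omega
  have hk' : kColoops M G + 4 = 5 + 1 := by omega
  have hP' : ∀ B, P B → 4 ≤ (B \ coloops M G).card := fun B h => (hP B).1 h
  have hB' : B ∈ membersIn M (Uq M (5 + 2) 5) G := (mem_thinMembers.1 hB).1
  have hBU : B ∈ Uq M (5 + 2) 5 := (mem_membersIn.1 hB').1
  have hBG : B ⊆ G := (subset_clF hBU).trans (mem_membersIn.1 hB').2
  have hKG : coloops M G ⊆ G := fun y hy => (mem_coloops.1 hy).1
  have hKB : coloops M G ⊆ B := coloops_subset_of_mem_thinMembers hG hd' hB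
  have hB3 : (B \ coloops M G).card + 1 = 4 := by
    have := card_sdiff_coloops_thin_ge hG hd' hk' hB
    have h4 : ¬ 4 ≤ (B \ coloops M G).card := fun h => hnP ((hP B).2 h)
    omega
  set n := (G \ coloops M G).card with hn
  have hGn : G.card - kColoops M G = n := by
    rw [hn, Finset.card_sdiff_of_subset hKG, kColoops_eq_card_coloops]
  have hr : (G \ insert z B).card = n - 4 := by
    rw [card_sdiff_insert_eq_dqm1 hG hd' hB hB3 hz, hGn]
  set D : ℚ := ((2 ^ (n - 4) - 1 : ℕ) : ℚ) with hD
  have hDpos : 0 < D := by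
    rw [hD]
    have : 2 ≤ 2 ^ (n - 4) := by
      calc 2 = 2 ^ 1 := by norm_num
        _ ≤ 2 ^ (n - 4) := Nat.pow_le_pow_right (by norm_num) (by omega)
    exact_mod_cast (by omega : 0 < 2 ^ (n - 4) - 1)
  have hT : ((tgtSets M 5 G B z).card : ℚ) = D := by
    rw [card_tgtSets hG hB' hz, hr]
  have hrho : rhoL M 5 G B z = loss M 5 G B z / D := by
    unfold rhoL; rw [hT]
  have hdl : ∀ S ∈ shadowAt M (5 + 2) 5 (Uq M (5 + 2) 5) G,
      dload M 5 G P (dshMissed M 5 G) S ≤ cap2 M 5 G S :=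
    fun S _ => dload_missed_le_cap2_three_two hG hd hk hs hl hP' S
  -- the good targets, their profiles, the bounds
  set 𝒯 := goodTargets M G ℓ B z with h𝒯def
  have h𝒯 : 𝒯 ⊆ tgtSets M 5 G B z := Finset.filter_subset _ _
  have hgood : ∀ T ∈ 𝒯, T ∈ tgtSets M 5 G B z ∧ 3 ≤ ((T \ coloops M G) \ ℓ).card := by
    intro T hT
    rw [h𝒯def, goodTargets, Finset.mem_filter] at hT
    exact hT
  have hTG : ∀ T ∈ 𝒯, T ⊆ G := fun T hT => subset_G_of_mem_shadowAt (mem_tgtSets.1 (hgood T hT).1).1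
  have hKT : ∀ T ∈ 𝒯, coloops M G ⊆ T := fun T hT =>
    hKB.trans ((Finset.subset_insert z B).trans (mem_tgtSets.1 (hgood T hT).1).2.1)
  have hT5 : ∀ T ∈ 𝒯, 4 + 1 ≤ (T \ coloops M G).card := by
    intro T hT
    obtain ⟨-, hQT, hcard⟩ := mem_tgtSets.1 (hgood T hT).1
    have hBT : B ⊆ T := (Finset.subset_insert z B).trans hQT
    have hsub : (T \ B) ∪ (B \ coloops M G) ⊆ T \ coloops M G := by
      intro x hx
      rw [Finset.mem_union, Finset.mem_sdiff, Finset.mem_sdiff] at hx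
      rw [Finset.mem_sdiff]
      rcases hx with ⟨hxT, hxB⟩ | ⟨hxB, hxK⟩
      · exact ⟨hxT, fun h => hxB (hKB h)⟩
      · exact ⟨hBT hxB, hxK⟩
    have hdisj : Disjoint (T \ B) (B \ coloops M G) := by
      rw [Finset.disjoint_left]; intro x hx hx'
      exact (Finset.mem_sdiff.1 hx).2 (Finset.mem_sdiff.1 hx').1
    have := Finset.card_le_card hsub
    rw [Finset.card_union_of_disjoint hdisj] at this
    omega
  have hGT : ∀ T ∈ 𝒯, (G \ T).card + (T \ coloops M G).card = n := by
    intro T hT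
    rw [hn, ← Finset.card_union_of_disjoint]
    · congr 1
      ext a
      simp only [Finset.mem_union, Finset.mem_sdiff]
      constructor
      · rintro (⟨haG, haT⟩ | ⟨haT, haK⟩)
        · exact ⟨haG, fun haK => haT (hKT T hT haK)⟩
        · exact ⟨hTG T hT haT, haK⟩
      · rintro ⟨haG, haK⟩
        by_cases haT : a ∈ T
        · exact Or.inr ⟨haT, haK⟩
        · exact Or.inl ⟨haG, haT⟩
    · rw [Finset.disjoint_left]; intro a ha hb
      exact (Finset.mem_sdiff.1 ha).2 (Finset.mem_sdiff.1 hb).1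
  have hprof : ∀ T ∈ 𝒯, (profileAt (coloops M G) ℓ T).1 + (profileAt (coloops M G) ℓ T).2 = (T \ coloops M G).card := by
    intro T _
    simp only [profileAt]
    rw [add_comm, Finset.card_sdiff_add_card_inter]
  -- the bounds `u`, `v`
  set u : Finset α → ℚ := fun T =>
    (lineCount (profileAt (coloops M G) ℓ T).1 (profileAt (coloops M G) ℓ T).2 : ℚ) * (E / D) with hu_def
  set v : Finset α → ℚ := fun T => cFloor n (T \ coloops M G).card with hv_def
  have hu : ∀ T ∈ 𝒯, pi2MassH M 5 G P T ≤ u T := by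
    intro T hT
    have := pi2MassH_le_lineCount hG hd hk (fun B h => (hP B).2 h) hE.le T ℓ hℓr (hTE T (hTG T hT))
    rw [hGn] at this
    simpa only [hu_def, profileAt, hD] using this
  have hv : ∀ T ∈ 𝒯, v T ≤ cap3 M 5 G P (dshMissed M 5 G) T := by
    intro T hT
    obtain ⟨hTt, h3⟩ := hgood T hT
    have hSh := (mem_tgtSets.1 hTt).1
    simp only [hv_def, cFloor]
    split_ifs with htop
    · -- the top levels: `cap2 = 1`
      have hc1 : cap2 M 5 G T = 1 := by
        apply cap2_eq_one_of_card_le hG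
        have := hGT T hT
        omega
      have hdl' := dload_missed_le_of_eleven hG hd hk hs hl h11 hP' T
      unfold cap3
      linarith
    · exact cap3_ge_of_three_off hG hd hk hs hl h11 hP' hℓr hℓ2 hℓV hℓcl hℓ hSh h3 (hT5 T hT)
  have hv0 : ∀ T ∈ 𝒯, 0 ≤ v T := fun T _ => cFloor_nonneg n _
  have hinc := lossIncomeH_ge_of_subfamily hG hd' hdl hB hnP hz hl0 h𝒯 u v hu hv hv0
  -- the subfamily sum is `(D/E) · Σ_{T ∈ 𝒯} F (profile T)`, `F (i, j) = cFloor n (i + j) / lineCount i j`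
  set F : ℕ × ℕ → ℚ := fun p => cFloor n (p.1 + p.2) / (lineCount p.1 p.2 : ℚ) with hF_def
  have hF0 : ∀ p, 0 ≤ F p := fun p => div_nonneg (cFloor_nonneg _ _) (by positivity)
  have hsum1 : ∑ T ∈ 𝒯, v T / u T = (D / E) * ∑ T ∈ 𝒯, F (profileAt (coloops M G) ℓ T) := by
    rw [Finset.mul_sum]
    apply Finset.sum_congr rfl
    intro T hT
    simp only [hu_def, hv_def, hF_def]
    rw [hprof T hT]
    field_simp
  -- regroup by profile
  set t : Finset (ℕ × ℕ) := (Finset.range (ℓ.card + 1)) ×ˢ (Finset.range (((G \ coloops M G) \ ℓ).card + 1)) with ht_def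
  have hfib : ∑ p ∈ t, ∑ T ∈ 𝒯.filter (fun T => profileAt (coloops M G) ℓ T = p), F (profileAt (coloops M G) ℓ T) ≤
      ∑ T ∈ 𝒯, F (profileAt (coloops M G) ℓ T) := by
    apply Finset.sum_fiberwise_le_sum_of_sum_fiber_nonneg
    intro p _
    exact Finset.sum_nonneg (fun T _ => hF0 _)
  have hfib' : ∀ p ∈ t, ∑ T ∈ 𝒯.filter (fun T => profileAt (coloops M G) ℓ T = p), F (profileAt (coloops M G) ℓ T) =
      ((𝒯.filter (fun T => profileAt (coloops M G) ℓ T = p)).card : ℚ) * F p := by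
    intro p _
    rw [← nsmul_eq_mul, ← Finset.sum_const]
    apply Finset.sum_congr rfl
    intro T hT
    rw [(Finset.mem_filter.1 hT).2]
  -- the qSum as a sum over `t`
  set i₀ := (profileAt (coloops M G) ℓ (insert z B)).1 with hi₀
  set j₀ := (profileAt (coloops M G) ℓ (insert z B)).2 with hj₀
  have hq : qSum ℓ.card ((G \ coloops M G) \ ℓ).card i₀ j₀ n =
      ∑ p ∈ t, if 3 ≤ p.2 ∧ i₀ ≤ p.1 ∧ j₀ ≤ p.2 ∧ p ≠ (i₀, j₀) then
        ((ℓ.card - i₀).choose (p.1 - i₀) * (((G \ coloops M G) \ ℓ).card - j₀).choose (p.2 - j₀) : ℚ) * F p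
      else 0 := by
    unfold qSum
    rw [ht_def, Finset.sum_product]
    apply Finset.sum_congr rfl; intro i _
    apply Finset.sum_congr rfl; intro j _
    simp only [hF_def]
    split_ifs <;> first | rw [mul_div_assoc] | rfl
  have hge : ∀ p ∈ t, (if 3 ≤ p.2 ∧ i₀ ≤ p.1 ∧ j₀ ≤ p.2 ∧ p ≠ (i₀, j₀) then
        ((ℓ.card - i₀).choose (p.1 - i₀) * (((G \ coloops M G) \ ℓ).card - j₀).choose (p.2 - j₀) : ℚ) * F p
      else 0) ≤ ((𝒯.filter (fun T => profileAt (coloops M G) ℓ T = p)).card : ℚ) * F p := by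
    intro p _
    split_ifs with hcond
    · apply mul_le_mul_of_nonneg_right _ (hF0 p)
      obtain ⟨h3, hi, hj, hne⟩ := hcond
      have hne' : (p.1, p.2) ≠ profileAt (coloops M G) ℓ (insert z B) := by
        intro h
        apply hne
        rw [hi₀, hj₀, Prod.mk.eta, ← h, Prod.mk.eta]
      have := card_fiber_ge_choose_mul_choose hG hd' hB hz hℓV h3 hne' hi hj
      exact_mod_cast this
    · exact mul_nonneg (by positivity) (hF0 p)
  have hqle : qSum ℓ.card ((G \ coloops M G) \ ℓ).card i₀ j₀ n ≤ ∑ T ∈ 𝒯, F (profileAt (coloops M G) ℓ T) := by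
    rw [hq]
    refine le_trans (Finset.sum_le_sum hge) (le_trans (le_of_eq ?_) hfib)
    apply Finset.sum_congr rfl
    intro p hp
    exact (hfib' p hp).symm
  -- assemble
  have hinc' : D ≤ lossIncomeH M 5 G P (dshMissed M 5 G) B z := by
    calc D = (D / E) * E := by field_simp
      _ ≤ (D / E) * qSum ℓ.card ((G \ coloops M G) \ ℓ).card i₀ j₀ n :=
          mul_le_mul_of_nonneg_left hsum (div_nonneg hDpos.le hE.le)
      _ ≤ (D / E) * ∑ T ∈ 𝒯, F (profileAt (coloops M G) ℓ T) :=
          mul_le_mul_of_nonneg_left hqle (div_nonneg hDpos.le hE.le)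
      _ = ∑ T ∈ 𝒯, v T / u T := hsum1.symm
      _ ≤ _ := hinc
  rw [hrho]
  have hl1 : 0 ≤ loss M 5 G B z := loss_nonneg' hG hd' B z
  calc loss M 5 G B z = loss M 5 G B z / D * D := by field_simp
    _ ≤ loss M 5 G B z / D * lossIncomeH M 5 G P (dshMissed M 5 G) B z :=
        mul_le_mul_of_nonneg_left hinc' (div_nonneg hl1 hDpos.le)

end Main

end PercRepro.Shadow
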